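import Mathlib.Analysis.Calculus.Deriv.MeanValue
import Mathlib.Algebra.BigOperators.Pi
import Literature.Analysis.ValidatedNumerics.KrawczykOperator
import HarnessLib

/-!
# An interval enclosure of the Jacobian over a convex set is a Lipschitz matrix

Topic `Literature/Analysis/ValidatedNumerics`. The computable half of Neumaier's Lipschitz-set
machinery (Neumaier 1990, §5.1, Proposition 5.1.4 and Corollary 5.1.5, parameter-free case):
if `F : ℝⁿ → ℝⁿ` is differentiable on a CONVEX set `D` with derivative `F' x`, and the interval
matrix `A = [A̲, Ā]` contains every Jacobian entry over `D`,
`A̲ᵢₖ ≤ (F' x eₖ)ᵢ ≤ Āᵢₖ` for all `x ∈ D`, then `A` is a LIPSCHITZ MATRIX for `F` on `D` in the sense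
of `KrawczykOperator.lean` (`IsLipschitzSetOn (matrixIcc A̲ Ā) F D`, Neumaier's (6)):
for all `x, y ∈ D` there is `M ∈ A` with `F x - F y = M (x - y)`. Proof: the mean value theorem
on the segment `[y, x] ⊆ D` applied to each component `Fᵢ` (Mathlib's `domain_mvt`) gives a point
`ξᵢ` of the segment with `Fᵢ x - Fᵢ y = (F' ξᵢ (x - y))ᵢ`; the matrix whose `i`-th row is the
`i`-th row of the Jacobian at `ξᵢ` lies in the entrywise hull `A` (Neumaier integrates the
Jacobian along the segment instead, which lands in the closed convex hull of the Jacobians; for an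
interval-matrix container the row-wise argument suffices). This is the MEAN VALUE FORM step of
validated solvers — e.g. `φ_h(x) ∈ φ_h(c) + [J](x - c)` for `x, c` in a box `W` with `[J] ⊇ Dφ_h(W)`
entrywise (Lohner's QR method; the `C¹` part of a validated ODE step) — and the hypothesis
"`A` is a Lipschitz matrix" of Krawczyk's test `KrawczykTest`.

## References

* A. Neumaier, *Interval Methods for Systems of Equations*, Cambridge UP (1990), §5.1,
  Prop. 5.1.4, Cor. 5.1.5 and the remark after eq. (6) (held copy, p. 163–164). [Neumaier1991]
* R. E. Moore, *Methods and Applications of Interval Analysis* (SIAM 1979), §2.3 / §8.1 (mean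
  value form). [Moore1979]
-/

noncomputable section

open Set Matrix

namespace Literature.Analysis.ValidatedNumerics

variable {n : ℕ}

/-- Expansion of a linear map along the coordinate vectors: `(L v)ᵢ = ∑ₖ (L eₖ)ᵢ vₖ`, i.e. `L v` is the
matrix–vector product of the matrix `(i, k) ↦ (L eₖ)ᵢ` with `v`. [folklore] -/
private theorem clm_apply_eq_mulVec (L : (Fin n → ℝ) →L[ℝ] (Fin n → ℝ)) (v : Fin n → ℝ) :
    L v = (Matrix.of fun i k => L (Pi.single k 1) i) *ᵥ v := by
  classical
  have hv : v = ∑ k, v k • Pi.single (M := fun _ => ℝ) k 1 := pi_eq_sum_univ' v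
  ext i
  conv_lhs => rw [hv]
  simp only [map_sum, map_smul, Finset.sum_apply, Pi.smul_apply, smul_eq_mul, mulVec, dotProduct,
    of_apply]
  exact Finset.sum_congr rfl fun k _ => mul_comm _ _

/-- **An interval enclosure of the Jacobian over a convex set is a Lipschitz matrix**
(Neumaier 1990, Prop. 5.1.4 / Cor. 5.1.5). Let `D ⊆ ℝⁿ` be convex, `F` differentiable within `D`
at every point of `D` with derivative `F' x`, and `A̲ᵢₖ ≤ (F' x eₖ)ᵢ ≤ Āᵢₖ` for all `x ∈ D` and all
`i, k`. Then `[A̲, Ā]` is a Lipschitz matrix for `F` on `D`: for all `x, y ∈ D` there is a real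
matrix `M` with `A̲ ≤ M ≤ Ā` entrywise and `F x - F y = M (x - y)`.
[cite: Neumaier1991, Prop. 5.1.4, Cor. 5.1.5] -/
theorem isLipschitzSetOn_matrixIcc_of_hasFDerivWithinAt {F : (Fin n → ℝ) → Fin n → ℝ}
    {F' : (Fin n → ℝ) → (Fin n → ℝ) →L[ℝ] (Fin n → ℝ)} {D : Set (Fin n → ℝ)} (hD : Convex ℝ D)
    (hF : ∀ x ∈ D, HasFDerivWithinAt F (F' x) D x) {Al Au : Matrix (Fin n) (Fin n) ℝ}
    (hA : ∀ x ∈ D, ∀ i k, Al i k ≤ F' x (Pi.single k 1) i ∧ F' x (Pi.single k 1) i ≤ Au i k) :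
    IsLipschitzSetOn (matrixIcc Al Au) F D := by
  intro x hx y hy
  -- componentwise mean value theorem on the segment `[y, x] ⊆ D`
  have hcomp : ∀ i, ∀ z ∈ D, HasFDerivWithinAt (fun w => F w i)
      ((ContinuousLinearMap.proj i).comp (F' z)) D z := fun i z hz =>
    (ContinuousLinearMap.proj (R := ℝ) (φ := fun _ : Fin n => ℝ) i).hasFDerivAt.comp_hasFDerivWithinAt
      z (hF z hz)
  have hmvt : ∀ i, ∃ ξ ∈ segment ℝ y x, F x i - F y i = ((ContinuousLinearMap.proj i).comp (F' ξ)) (x - y) :=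
    fun i => domain_mvt (hcomp i) hD hy hx
  choose ξ hξseg hξ using hmvt
  have hξD : ∀ i, ξ i ∈ D := fun i => hD.segment_subset hy hx (hξseg i)
  refine ⟨Matrix.of fun i k => F' (ξ i) (Pi.single k 1) i, fun i k => ?_, ?_⟩
  · simpa only [of_apply] using hA (ξ i) (hξD i) i k
  · ext i
    rw [Pi.sub_apply, hξ i, ContinuousLinearMap.coe_comp, Function.comp_apply,
      ContinuousLinearMap.proj_apply, clm_apply_eq_mulVec (F' (ξ i)) (x - y)]
    simp only [mulVec, dotProduct, of_apply]

/-- **Mean value form over a box** (the same fact, unfolded; Neumaier 1990 Cor. 5.1.5, Moore's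
mean value form): under the hypotheses of `isLipschitzSetOn_matrixIcc_of_hasFDerivWithinAt`, for all
`x, c ∈ D`, `F x = F c + M (x - c)` for some matrix `M` with `A̲ ≤ M ≤ Ā` entrywise — so
`F x ∈ F c + [A̲, Ā](x - c)` (interval evaluation). This is the inclusion
`φ(x) ∈ φ(c) + [J](x - c)`, `[J] ⊇ Dφ(W)`, of a `C¹` (Lohner-type) validated integration step.
[cite: Neumaier1991, Cor. 5.1.5] -/
theorem exists_matrixIcc_meanValue_of_hasFDerivWithinAt {F : (Fin n → ℝ) → Fin n → ℝ}
    {F' : (Fin n → ℝ) → (Fin n → ℝ) →L[ℝ] (Fin n → ℝ)} {D : Set (Fin n → ℝ)} (hD : Convex ℝ D)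
    (hF : ∀ x ∈ D, HasFDerivWithinAt F (F' x) D x) {Al Au : Matrix (Fin n) (Fin n) ℝ}
    (hA : ∀ x ∈ D, ∀ i k, Al i k ≤ F' x (Pi.single k 1) i ∧ F' x (Pi.single k 1) i ≤ Au i k)
    {x c : Fin n → ℝ} (hx : x ∈ D) (hc : c ∈ D) :
    ∃ M ∈ matrixIcc Al Au, F x = F c + M *ᵥ (x - c) := by
  obtain ⟨M, hM, hMx⟩ := isLipschitzSetOn_matrixIcc_of_hasFDerivWithinAt hD hF hA x hx c hc
  exact ⟨M, hM, by rw [← hMx]; abel⟩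

end Literature.Analysis.ValidatedNumerics

end
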